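import Mathlib

/-!
# A telescoping (discrete Poincaré) inequality for finitely supported sequences on `ℤ`

`sum_sq_le_sq_mul_sum_sq_sub_shift`: if `f : ℤ → ℝ` vanishes off `[a, a + p·s)`, then
`Σ_j f_j² ≤ p² · Σ_j (f_j − f_{j+s})²` (sums over any finite window `K ⊇ [a, a + 2ps)`).
A profile cannot be almost invariant under a shift that is a fixed fraction of its support.
Used by `RotationJoining/Negative/LayeredMeasure.lean` (crux stmt-CriticalPhenomena-18763,
negative-side support). Elementary (telescoping + Cauchy–Schwarz). [folklore]
-/

namespace Summit.CriticalPhenomena.Ising3DConformalLimit.Theorems.RotationJoining.Negative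

open Finset

noncomputable section

/-! ## §3 A telescoping (discrete Poincaré) inequality for finitely supported sequences -/

/-- If `f : ℤ → ℝ` vanishes off `[a, a + p·s)`, then `Σ f² ≤ p² Σ_j (f j - f (j+s))²` (sums over
any finite `K ⊇ [a, a + 2ps)`): a profile cannot be almost invariant under a shift that is a fixed
fraction of its support. -/
theorem sum_sq_le_sq_mul_sum_sq_sub_shift (f : ℤ → ℝ) (a : ℤ) (s p : ℕ)
    (hsupp : ∀ j, f j ≠ 0 → a ≤ j ∧ j < a + p * s) (K : Finset ℤ)
    (hK : ∀ j, a ≤ j → j < a + 2 * p * s → j ∈ K) :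
    ∑ j ∈ K, f j ^ 2 ≤ (p:ℝ) ^ 2 * ∑ j ∈ K, (f j - f (j + s)) ^ 2 := by
  classical
  set D : ℤ → ℝ := fun j => (f j - f (j + s)) ^ 2 with hD
  have hDnn : ∀ j, 0 ≤ D j := fun j => sq_nonneg _
  set J : Finset ℤ := K.filter (fun j => a ≤ j ∧ j < a + p * s) with hJ
  -- telescoping representation on `j ≥ a`
  have htel : ∀ j, a ≤ j → f j = ∑ i ∈ Finset.range p, (f (j + i * s) - f (j + (i + 1) * s)) := by
    intro j hj
    have h := Finset.sum_range_sub' (fun i : ℕ => f (j + i * s)) p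
    simp only [Nat.cast_zero, zero_mul, add_zero, Nat.cast_add, Nat.cast_one] at h
    have hzero : f (j + p * s) = 0 := by
      by_contra hne
      have := (hsupp _ hne).2
      nlinarith
    rw [h, hzero, sub_zero]
  -- Cauchy–Schwarz per point
  have hpt : ∀ j, a ≤ j → f j ^ 2 ≤ (p:ℝ) * ∑ i ∈ Finset.range p, D (j + i * s) := by
    intro j hj
    have h1 := sq_sum_le_card_mul_sum_sq (s := Finset.range p)
      (f := fun i : ℕ => f (j + i * s) - f (j + (i + 1) * s))
    rw [← htel j hj, Finset.card_range] at h1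
    refine h1.trans (le_of_eq ?_)
    congr 1
    refine Finset.sum_congr rfl (fun i _ => ?_)
    simp only [hD]
    ring_nf
  -- restrict the left sum to J
  have hKJ : ∑ j ∈ K, f j ^ 2 = ∑ j ∈ J, f j ^ 2 := by
    rw [hJ, Finset.sum_filter]
    refine Finset.sum_congr rfl (fun j _ => ?_)
    split_ifs with h
    · rfl
    · have : f j = 0 := by
        by_contra hne
        exact h (hsupp j hne)
      simp [this]
  -- shifted sums are dominated by the full sum
  have hshift : ∀ i ∈ Finset.range p, ∑ j ∈ J, D (j + i * s) ≤ ∑ j ∈ K, D j := by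
    intro i hi
    rw [Finset.mem_range] at hi
    have hinj : Set.InjOn (fun j : ℤ => j + i * s) J := fun x _ y _ hxy => by simpa using hxy
    rw [← Finset.sum_image (f := D) hinj]
    refine Finset.sum_le_sum_of_subset_of_nonneg ?_ (fun j _ _ => hDnn j)
    intro x hx
    rw [Finset.mem_image] at hx
    obtain ⟨j, hj, rfl⟩ := hx
    rw [hJ, Finset.mem_filter] at hj
    have hi' : (i:ℤ) + 1 ≤ p := by exact_mod_cast hi
    apply hK
    · nlinarith [hj.2.1]
    · nlinarith [hj.2.2]
  calc ∑ j ∈ K, f j ^ 2 = ∑ j ∈ J, f j ^ 2 := hKJ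
    _ ≤ ∑ j ∈ J, (p:ℝ) * ∑ i ∈ Finset.range p, D (j + i * s) :=
        Finset.sum_le_sum (fun j hj => hpt j (by rw [hJ, Finset.mem_filter] at hj; exact hj.2.1))
    _ = (p:ℝ) * ∑ i ∈ Finset.range p, ∑ j ∈ J, D (j + i * s) := by
        rw [← Finset.mul_sum, Finset.sum_comm]
    _ ≤ (p:ℝ) * ∑ i ∈ Finset.range p, ∑ j ∈ K, D j := by
        gcongr with i hi
        exact hshift i hi
    _ = (p:ℝ) ^ 2 * ∑ j ∈ K, (f j - f (j + s)) ^ 2 := by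
        rw [Finset.sum_const, Finset.card_range, nsmul_eq_mul]; ring

end

end Summit.CriticalPhenomena.Ising3DConformalLimit.Theorems.RotationJoining.Negative
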